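import Mathlib
import HarnessLib
import Summits.HubbardSuperconductivity.HubbardSuperconductivity.Theorems.KLProgrammeKLRegimeEngineV8PairTransferExport6
import Summits.HubbardSuperconductivity.HubbardSuperconductivity.Theorems.KLProgrammeKLRegimeEnginePairTransferRelDoor

/-!
# Route `KLProgramme` — ENGINE child gen 8 (stmt-HubbardSuperconductivity-20437 `KLRegimeEngineV17F2`), skeleton-v2 export class #5 «(S)-transfer», names-only LAYER
# «Export7» = Export6 ∘ {TWO-PACKAGE step (engine `G`, thermal key `Gth`), cap RAISED to a producer-feasible numeral} — located finding «(X).3-CAP-RIGID»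
# (KL STATUS 2026-08-28 ≈02:20Z, HOME/p1/CLASS5-CAP-RIGID.md; ruling (R103) «REL-DIRECT GO»; cell gate-hubbard-kl, seat hubbard-kl-p1 g14 = class-#5 text / door owner (R54d); the Export7 TEXT OF RECORD).

WHY.  Export6's cap `klCTcap = 2⁻¹⁹` is the composition of two rigid links that are NOT properties of the relative family: HOST (the pinned relative bar goes under
rev 2's single-prefactor `transferBarAt … r′ …`, `r′ ≥ 2r·15367` through its constant-free cubic/`1/L`/same-`G` thermal slots) ∘ CONSUME (p581707 charges the FULL
`r′·G.phGain (n−1) ≤ 4r′·G.phGain n` to the frozen (E2-F2)ₙ ph slot: `4r′ ≤ 1 − s_Ea`, scale-invariant); and a second rigid cap `r ≤ 2⁻¹²·⁹` from same-`G` thermal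
inheritance.  The producer's per-step room hosts a one-loop mixed ph bubble whose constant in the index-mass currency is `≳ 2²` (certified) — the cap is infeasible.
The DIRECT door `pairLadderStepAtV17F2_of_relFamilyK5` (`…PairTransferRelDoor`, p596929) removes HOST∘CONSUME (every inherited slot meets the (E2-F2)ₙ line with a
raisable coefficient: `transferBarRelIdx_pinned_le_slots`); the thermal rigidity is removed by keying the relative family at a FIXED thermal package `Gth` distinct from
the engine's `G` (the family reads `G` in its thermal slot only: `transferBarRelAtW`).  This layer is the corresponding TEXT:
* §1 **`klEngGeoTh := {klEngGeo8 with CF := 2⁴⁰}`** (only `.CF` is ever read by the family), **`klCTcap7 := 2²⁰`**; numerals: consumer thermal weight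
  `2·klCTcap7·15367·klEngGeoTh.CF ≤ 2⁷⁵` (vs `klEngGeo10.CF ≥ 2⁸⁰`), ph share `8·klCTcap7·15367 ≤ 2⁻¹⁵·2⁵²`;
* §2 **`PairTransferStep7 P R Q₀ G Gth r u`** := `PairTransferStep6`'s binder list byte-verbatim (history `HistP klPredsV17F2 … G …` at the ENGINE package) with the K5
  families — history `j < n` and conclusion `n` — keyed at `Gth`; `PairTransferStep6.toStep7` (the diagonal `Gth = G` is Export6's step); **`IsTransferPkg7`** (cap
  `klCTcap7`), deferred **`klTransferPkg7 / klCT7 / klCTu7`** keyed `(P R Q₀ G Gth)`, `klCT7_nonneg`, **`klCT7_le_klCTcap7`**, `klCTu7_pos`, `pairTransferStep7_klCT7_of_exists/_of`;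
* §3 the unroll `pairTransferRelFamilyK5_all_of_step7` and §C's line **`pairTransferRelFamilyK5_klCT7_all_of_exists`** (families at `Gth`);
* §4 the (c) closer's (E2-F2) input BY NAME: **`pairLadderStepAtV17F2_of_relFamilyK5_klCT7`** = the direct door at `(r, Gth) := (klCT7 …, Gth)` — NO `transferBarAt`,
  NO `klCTpin`, NO hosting; the inherited content's numeric shares `klCT7_ph_share_le` / `klCT7_thermal_weight_le`.
RENDER DELTA (rev 13/14 candidate): (X).3 `∃ e, IsTransferPkg7 e ∧ PairTransferStep7 P R (klEngQ7 P R) klEngGeo1x klEngGeoTh e.1 e.2`; (c) `htr : ∀ j ≤ n,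
PairTransferRelFamilyK5 L M klEngGeoTh P (klCT7 P R (klEngQ7 P R) klEngGeo1x klEngGeoTh) β U μ j`; §C `pairTransferRelFamilyK5_klCT7_all_of_exists h5 …`;
#14 entry `klCTu7 P R (klEngQ7 P R) klEngGeo1x klEngGeoTh (klEngQ9c P R) cc`.  Definitions with bodies + order lemmas; nothing about the model is asserted; nothing asserts superconductivity.
-/

noncomputable section

namespace Summit.HubbardSuperconductivity.HubbardSuperconductivity.Theorems.EngineV8

set_option linter.dupNamespace false -- summit = problem name (single-conjunct summit), D-0017

open Real Finset Literature.MathematicalPhysics.QuantumLattice Literature.Probability.LatticeModels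
open Literature.MathematicalPhysics.QuantumLattice.FermiRG
open Summit.HubbardSuperconductivity.HubbardSuperconductivity.Theorems.KLProgrammeLegKernels
open Summit.HubbardSuperconductivity.HubbardSuperconductivity.Theorems.DispersionFlow
open Summit.HubbardSuperconductivity.HubbardSuperconductivity.Theorems.KLRegimeSplit

/-! ## §1 The thermal package of the relative family and the raised cap (numerals) -/

/-- **`klEngGeoTh`** — the FIXED thermal package at which the class-#5 relative family is keyed: `klEngGeo8` with `CF := 2⁴⁰`.  The family's bar `transferBarRelIdx L G …`
reads `G` in its thermal slot `r·G.CF·(KlamU)²·4^{−(n_β−n)}·ms` ONLY, so only `.CF` matters: large enough for the producer's thermal-layer floor (`r·CF ≥ c_th`), small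
against the engine's `CF ≥ 2⁸⁰` so that the consumer's thermal inheritance is raisable (`2r·15367·klEngGeoTh.CF ≤ share·G.CF`). -/
def klEngGeoTh : GeoConsts := { klEngGeo8 with CF := 2 ^ 40 }

/-- `klEngGeoTh.CF = 2⁴⁰`. -/
theorem klEngGeoTh_CF : klEngGeoTh.CF = 2 ^ 40 := rfl
/-- `0 ≤ klEngGeoTh.CF`. -/
theorem klEngGeoTh_CF_nonneg : 0 ≤ klEngGeoTh.CF := by rw [klEngGeoTh_CF]; positivity
/-- Every non-thermal field of `klEngGeoTh` is `klEngGeo8`'s (e.g. `phGain`). -/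
theorem klEngGeoTh_phGain : klEngGeoTh.phGain = klEngGeo8.phGain := rfl
/-- … and `bhi`. -/
theorem klEngGeoTh_bhi : klEngGeoTh.bhi = klEngGeo8.bhi := rfl

/-- **`klCTcap7 := 2²⁰`** — the producer-feasible cap on the class-#5 relative prefactor under the DIRECT consumer door (every inherited slot raisable). -/
def klCTcap7 : ℝ := 2 ^ 20

/-- `klCTcap7 = 2²⁰`. -/
theorem klCTcap7_eq : klCTcap7 = 2 ^ 20 := rfl
/-- `0 < klCTcap7`. -/
theorem klCTcap7_pos : 0 < klCTcap7 := by unfold klCTcap7; positivity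
/-- The old cap is below the new one. -/
theorem klCTcap_le_klCTcap7 : klCTcap ≤ klCTcap7 := by unfold klCTcap klCTcap7; norm_num

/-- **Consumer ph-share numeral**: `8·klCTcap7·15367 ≤ 2⁻¹⁵·2⁵²` (the inherited ph/floor content `(8r·15367/C)·(KlamU)²·G.phGain` at `C = 2⁵²` takes at most `2⁻¹⁵` of the slot). -/
theorem klCTcap7_ph_share : 8 * klCTcap7 * 15367 ≤ (2 : ℝ)⁻¹ ^ 15 * 2 ^ 52 := by unfold klCTcap7; norm_num

/-- **Consumer thermal-weight numeral**: `2·klCTcap7·15367·klEngGeoTh.CF ≤ 2⁷⁵` (against an engine `CF ≥ 2⁸⁰`: share `≤ 2⁻⁵`). -/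
theorem klCTcap7_thermal_weight : 2 * klCTcap7 * 15367 * klEngGeoTh.CF ≤ 2 ^ 75 := by rw [klEngGeoTh_CF]; unfold klCTcap7; norm_num

/-! ## §2 The two-package step, the capped admissibility predicate and the deferred package -/

/-- **`PairTransferStep7 P R Q₀ G Gth r u`** — class #5's induction step with the ENGINE package `G` (first binder `G.WF`; the public history `HistP klPredsV17F2 … G …`) and
the relative families keyed at the THERMAL package `Gth` (history `j < n` and conclusion `n`): `PairTransferStep6`'s binder list byte-verbatim otherwise. -/
def PairTransferStep7 (P : SplitConsts) (R : RenConsts) (Q₀ : EngConsts) (G Gth : GeoConsts) (r : ℝ) (u : EngConsts → ℝ → ℝ) : Prop :=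
  G.WF → ∀ Q : EngConsts, Q₀.IsRaiseOf Q →
    ∀ cc : ℝ, 0 < cc → cc ≤ klEngC₃6 P R →
      ∀ μ ∈ klWindowC, ∀ U : ℝ, 0 < U → U ≤ klEngU₀10 P R cc → U ≤ u Q cc →
        ∀ β : ℝ, klBetaMin ≤ β → β ≤ Real.exp (cc / U ^ 2) →
          ∀ (L M : ℕ) [NeZero L] [NeZero M], klEngL₄ P R β U ≤ L → klEngM₃ β U L ≤ M →
            ∀ n : ℕ, n ≤ nScales β + 1 → IsKLRegime U cc (-(n : ℤ)) →
              HistP klPredsV17F2 L M G P Q R β U μ 0 n →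
                FrameOK R U (nScales β) μ (klFlowFrameU L M β U μ n) →
                  (∀ j ≤ n, LevelsUExportMixedAt L M (klCU2 P R Q₀) P β U μ j) →
                    (∀ j < n, PairTransferRelFamilyK5 L M Gth P r β U μ j) →
                      PairTransferRelFamilyK5 L M Gth P r β U μ n

/-- The diagonal `Gth = G` is Export6's step. -/
theorem PairTransferStep6.toStep7 {P : SplitConsts} {R : RenConsts} {Q₀ : EngConsts} {G : GeoConsts} {r : ℝ} {u : EngConsts → ℝ → ℝ}
    (h : PairTransferStep6 P R Q₀ G r u) : PairTransferStep7 P R Q₀ G G r u := h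

/-- … and conversely. -/
theorem PairTransferStep7.toStep6 {P : SplitConsts} {R : RenConsts} {Q₀ : EngConsts} {G : GeoConsts} {r : ℝ} {u : EngConsts → ℝ → ℝ}
    (h : PairTransferStep7 P R Q₀ G G r u) : PairTransferStep6 P R Q₀ G r u := h

/-- **An admissible class-#5 package WITH THE RAISED CAP**: `0 ≤ r ≤ klCTcap7` and a coupling threshold positive at every raised package. -/
def IsTransferPkg7 (e : ℝ × (EngConsts → ℝ → ℝ)) : Prop := 0 ≤ e.1 ∧ e.1 ≤ klCTcap7 ∧ ∀ Q cc, 0 < e.2 Q cc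

/-- An Export6-capped package is Export7-capped. -/
theorem IsTransferPkg6.toPkg7 {e : ℝ × (EngConsts → ℝ → ℝ)} (h : IsTransferPkg6 e) : IsTransferPkg7 e := ⟨h.1, h.2.1.trans klCTcap_le_klCTcap7, h.2.2⟩

/-- A capped package is a rev-3 package. -/
theorem IsTransferPkg7.toPkg4 {e : ℝ × (EngConsts → ℝ → ℝ)} (h : IsTransferPkg7 e) : IsTransferPkg4 e := ⟨h.1, h.2.2⟩

/-- The trivial package `(0, 1)` is capped-admissible. -/
theorem isTransferPkg7_zero : IsTransferPkg7 (0, fun _ _ => 1) := ⟨le_rfl, klCTcap7_pos.le, fun _ _ => one_pos⟩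

section Deferred

variable (P : SplitConsts) (R : RenConsts) (Q₀ : EngConsts) (G Gth : GeoConsts)

/-- **The deferred capped transfer package at `(G, Gth)`**: SOME capped-admissible `(r, u)` with `PairTransferStep7 P R Q₀ G Gth r u`, if one exists, else `(0, 1)`. -/
def klTransferPkg7 : ℝ × (EngConsts → ℝ → ℝ) :=
  open scoped Classical in
  if h : ∃ e : ℝ × (EngConsts → ℝ → ℝ), IsTransferPkg7 e ∧ PairTransferStep7 P R Q₀ G Gth e.1 e.2 then Classical.choose h else (0, fun _ _ => 1)

/-- **`klCT7 P R Q₀ G Gth`** — the deferred capped transfer constant (stub (c)'s `htr` reads it at `(Q₀, G, Gth) = (klEngQ7 P R, klEngGeo1x, klEngGeoTh)`). -/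
def klCT7 : ℝ := (klTransferPkg7 P R Q₀ G Gth).1

/-- **`klCTu7 P R Q₀ G Gth`** — the deferred coupling threshold (the U-door's class-#5 `min` entry at `(klEngQ9c P R, cc)`). -/
def klCTu7 : EngConsts → ℝ → ℝ := (klTransferPkg7 P R Q₀ G Gth).2

/-- The deferred package is capped-admissible (unconditionally). -/
theorem isTransferPkg7_klTransferPkg7 : IsTransferPkg7 (klTransferPkg7 P R Q₀ G Gth) := by
  classical
  unfold klTransferPkg7
  split_ifs with h
  · exact (Classical.choose_spec h).1
  · exact isTransferPkg7_zero

/-- `0 ≤ klCT7 P R Q₀ G Gth`. -/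
theorem klCT7_nonneg : 0 ≤ klCT7 P R Q₀ G Gth := (isTransferPkg7_klTransferPkg7 P R Q₀ G Gth).1

/-- **`klCT7 P R Q₀ G Gth ≤ klCTcap7`** — what the (E2-F2) consumer reads. -/
theorem klCT7_le_klCTcap7 : klCT7 P R Q₀ G Gth ≤ klCTcap7 := (isTransferPkg7_klTransferPkg7 P R Q₀ G Gth).2.1

/-- `0 < klCTu7 P R Q₀ G Gth Q cc`. -/
theorem klCTu7_pos (Q : EngConsts) (cc : ℝ) : 0 < klCTu7 P R Q₀ G Gth Q cc := (isTransferPkg7_klTransferPkg7 P R Q₀ G Gth).2.2 Q cc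

/-- **Consumer ph share at the deferred constant**: `8·klCT7·15367/2⁵² ≤ 2⁻¹⁵`. -/
theorem klCT7_ph_share_le : 8 * klCT7 P R Q₀ G Gth * 15367 / 2 ^ 52 ≤ (2 : ℝ)⁻¹ ^ 15 := by
  have h := klCT7_le_klCTcap7 P R Q₀ G Gth
  have h0 := klCT7_nonneg P R Q₀ G Gth
  rw [div_le_iff₀ (by positivity)]
  have := klCTcap7_ph_share
  nlinarith

/-- **Consumer thermal weight at the deferred constant, at `Gth = klEngGeoTh`**: `2·klCT7·15367·klEngGeoTh.CF ≤ 2⁷⁵`. -/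
theorem klCT7_thermal_weight_le (G : GeoConsts) : 2 * klCT7 P R Q₀ G klEngGeoTh * 15367 * klEngGeoTh.CF ≤ 2 ^ 75 := by
  have h := klCT7_le_klCTcap7 P R Q₀ G klEngGeoTh
  have h0 := klCT7_nonneg P R Q₀ G klEngGeoTh
  have hCF := klEngGeoTh_CF_nonneg
  calc 2 * klCT7 P R Q₀ G klEngGeoTh * 15367 * klEngGeoTh.CF ≤ 2 * klCTcap7 * 15367 * klEngGeoTh.CF := by gcongr
    _ ≤ 2 ^ 75 := klCTcap7_thermal_weight

variable {P R Q₀ G Gth}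

/-- **The step holds for the deferred capped package as soon as it holds for some capped-admissible package** (how §C reads (X).3 under Export7). -/
theorem pairTransferStep7_klCT7_of_exists (h : ∃ e : ℝ × (EngConsts → ℝ → ℝ), IsTransferPkg7 e ∧ PairTransferStep7 P R Q₀ G Gth e.1 e.2) :
    PairTransferStep7 P R Q₀ G Gth (klCT7 P R Q₀ G Gth) (klCTu7 P R Q₀ G Gth) := by
  classical
  have hpkg : klTransferPkg7 P R Q₀ G Gth = Classical.choose h := by
    unfold klTransferPkg7
    rw [dif_pos h]
  unfold klCT7 klCTu7
  rw [hpkg]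
  exact (Classical.choose_spec h).2

/-- Packaging an explicit witness (`0 ≤ r ≤ klCTcap7`, `u > 0`). -/
theorem pairTransferStep7_klCT7_of {r : ℝ} {u : EngConsts → ℝ → ℝ} (hr : 0 ≤ r) (hrc : r ≤ klCTcap7) (hu : ∀ Q cc, 0 < u Q cc)
    (hs : PairTransferStep7 P R Q₀ G Gth r u) : PairTransferStep7 P R Q₀ G Gth (klCT7 P R Q₀ G Gth) (klCTu7 P R Q₀ G Gth) :=
  pairTransferStep7_klCT7_of_exists ⟨(r, u), ⟨hr, hrc, hu⟩, hs⟩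

/-- The rev-13/14 (X).3 conjunct from an explicit capped witness. -/
theorem exists_isTransferPkg7_of_step7 {r : ℝ} {u : EngConsts → ℝ → ℝ} (hr : 0 ≤ r) (hrc : r ≤ klCTcap7) (hu : ∀ Q cc, 0 < u Q cc)
    (hs : PairTransferStep7 P R Q₀ G Gth r u) : ∃ e : ℝ × (EngConsts → ℝ → ℝ), IsTransferPkg7 e ∧ PairTransferStep7 P R Q₀ G Gth e.1 e.2 :=
  ⟨(r, u), ⟨hr, hrc, hu⟩, hs⟩

end Deferred

/-! ## §3 The unroll at the deferred capped package (the term §C's `htr` line calls) -/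

section Unroll

variable {P : SplitConsts} {R : RenConsts} {Q₀ Q : EngConsts} {G Gth : GeoConsts} {cc μ U β : ℝ} {L M : ℕ} [NeZero L] [NeZero M]

/-- **CLASS #5 UNROLLED from the two-package step**: `PairTransferStep7 P R Q₀ G Gth r u`, `G.WF`, a raise `Q` of `Q₀`, the v2 binders, the bare frame's admissibility `h0`,
`R.WF2`, the public history up to `n ≤ n_β + 1` AT `(G, Q)` and the class-#1 merged exports at every `j ≤ n` ⟹ the K5 family AT `Gth` at every `j ≤ n`
(argument list = `pairTransferRelFamilyK5_all_of_step6`'s verbatim). -/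
theorem pairTransferRelFamilyK5_all_of_step7 {r : ℝ} {u : EngConsts → ℝ → ℝ} (hstep : PairTransferStep7 P R Q₀ G Gth r u) (hG : G.WF) (hQ : Q₀.IsRaiseOf Q)
    (hcc0 : 0 < cc) (hcc : cc ≤ klEngC₃6 P R) (hμ : μ ∈ klWindowC) (h0 : FrameOK R U (nScales β) μ 0) (hU : 0 < U) (hU10 : U ≤ klEngU₀10 P R cc)
    (hUu : U ≤ u Q cc) (hβ : klBetaMin ≤ β) (hβc : β ≤ Real.exp (cc / U ^ 2)) (hL : klEngL₄ P R β U ≤ L) (hM : klEngM₃ β U L ≤ M) (hR : R.WF2)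
    {n : ℕ} (hn : n ≤ nScales β + 1) (hhist : HistP klPredsV17F2 L M G P Q R β U μ 0 n)
    (hlev : ∀ j ≤ n, LevelsUExportMixedAt L M (klCU2 P R Q₀) P β U μ j) : ∀ j ≤ n, PairTransferRelFamilyK5 L M Gth P r β U μ j :=
  exports_all_of_step₂ (E := fun j => LevelsUExportMixedAt L M (klCU2 P R Q₀) P β U μ j) (F := fun j => PairTransferRelFamilyK5 L M Gth P r β U μ j) (N := n)
    hlev
    (fun m hm hE hist => by
      have hmn : m ≤ nScales β + 1 := hm.trans hn
      have hhm : HistP klPredsV17F2 L M G P Q R β U μ 0 m := histP_klPredsV17F2_of_le hhist hm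
      exact hstep hG Q hQ cc hcc0 hcc μ hμ U hU hU10 hUu β hβ hβc L M hL hM m hmn (isKLRegime_of_le_nScales_succ hcc0.le hβ hβc hmn) hhm
        (frameOK_klFlowFrameU_of_histP hR h0 hmn hhm) hE hist)
    n le_rfl

/-- **CLASS #5 UNROLLED at the deferred capped package** (§C's `htr` line under Export7): from `∃ e, IsTransferPkg7 e ∧ PairTransferStep7 P R Q₀ G Gth e.1 e.2`, under the
same binders with `U ≤ klCTu7 P R Q₀ G Gth Q cc`: `PairTransferRelFamilyK5 L M Gth P (klCT7 P R Q₀ G Gth) β U μ j` at every `j ≤ n`. -/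
theorem pairTransferRelFamilyK5_klCT7_all_of_exists (hex : ∃ e : ℝ × (EngConsts → ℝ → ℝ), IsTransferPkg7 e ∧ PairTransferStep7 P R Q₀ G Gth e.1 e.2) (hG : G.WF)
    (hQ : Q₀.IsRaiseOf Q) (hcc0 : 0 < cc) (hcc : cc ≤ klEngC₃6 P R) (hμ : μ ∈ klWindowC) (h0 : FrameOK R U (nScales β) μ 0) (hU : 0 < U)
    (hU10 : U ≤ klEngU₀10 P R cc) (hUu : U ≤ klCTu7 P R Q₀ G Gth Q cc) (hβ : klBetaMin ≤ β) (hβc : β ≤ Real.exp (cc / U ^ 2)) (hL : klEngL₄ P R β U ≤ L)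
    (hM : klEngM₃ β U L ≤ M) (hR : R.WF2) {n : ℕ} (hn : n ≤ nScales β + 1) (hhist : HistP klPredsV17F2 L M G P Q R β U μ 0 n)
    (hlev : ∀ j ≤ n, LevelsUExportMixedAt L M (klCU2 P R Q₀) P β U μ j) : ∀ j ≤ n, PairTransferRelFamilyK5 L M Gth P (klCT7 P R Q₀ G Gth) β U μ j :=
  pairTransferRelFamilyK5_all_of_step7 (pairTransferStep7_klCT7_of_exists hex) hG hQ hcc0 hcc hμ h0 hU hU10 hUu hβ hβc hL hM hR hn hhist hlev

end Unroll

/-! ## §4 The (c) closer's (E2-F2) input BY NAME — the DIRECT door at the deferred constant (no `transferBarAt`, no `klCTpin`, no hosting) -/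

section Direct

variable {L M : ℕ} [NeZero L] [NeZero M]

/-- **(E2-F2) `PairLadderStepAtV17F2 L M G P Q β U μ n` (`1 ≤ n ≤ n_β + 1`) DIRECTLY from the `htr` family at `n − 1`**: `PairTransferRelFamilyK5 L M Gth P (klCT7 …) β U μ (n−1)`
(`0 ≤ Gth.CF`, `0 ≤ P.Klam`), the member `s_{n−1,n}`, the bar `Tb := transferBarRelIdx L Gth P (klCT7 …) β U (n−1) (n−1)` (content slot by slot: `transferBarRelIdx_pinned_le_slots`,
shares `klCT7_ph_share_le` / `klCT7_thermal_weight_le`) and the (c) closer's tower data — `pairLadderStepAtV17F2_of_relFamilyK5` at `r := klCT7 P R Q₀ G′ Gth`. -/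
theorem pairLadderStepAtV17F2_of_relFamilyK5_klCT7 {G G' Gth : GeoConsts} (hCF : 0 ≤ Gth.CF) {P : SplitConsts} (hKl : 0 ≤ P.Klam) {Q Q₀ : EngConsts} {R Rn : RenConsts}
    {N : ℕ} {β U μ : ℝ} {n : ℕ} {m : ℝ} (hn : 1 ≤ n) (hnS : n ≤ nScales β + 1) (hm : 0 ≤ m)
    (hK : FrameOK Rn U N μ (klFlowFrameU L M β U μ (n - 1))) (hβ : klBetaMin ≤ β) (hβL : β ≤ L) (hG : (2 : ℝ) ^ 18 ≤ G.bhi)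
    (hfam : PairTransferRelFamilyK5 L M Gth P (klCT7 P R Q₀ G' Gth) β U μ (n - 1))
    (hC₀ : ∀ Qm s t, ‖klPairArrayF L M β U μ (n - 1) Qm s t‖ ≤ m)
    (hsm₀ : m * (G.bhi / 4) ≤ 1 / 3)
    (htower : ∀ Qm : TorusSite 2 L, IsPairClassAt L Qm n →
      ∃ (X Nm : Matrix (TorusSite 2 L) (TorusSite 2 L) ℂ) (w₁ : TorusSite 2 L → ℝ) (Ea E₁ : TorusSite 2 L → TorusSite 2 L → ℝ) (r' e₁ : ℝ),
        0 ≤ r' ∧ 0 ≤ e₁ ∧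
        (∀ x y, ¬(x ∈ klBall L μ 0 ∧ y ∈ klBall L μ 0) → X x y = 0) ∧
        (∀ k ∈ klBall L μ 0, ∀ k' ∈ klBall L μ 0,
          X k k' = klCovSmearedPairAmplitude L M β U μ (klFlowFrameU L M β U μ (n - 1)) (n - 1)
            (softCovOf L M β μ (klFlowFrameU L M β U μ (n - 1)) (softSymbolCompl L M β μ (klFlowFrameU L M β U μ (n - 1)) (n - 1) n)) Qm k k') ∧
        (∀ x y, 0 ≤ Ea x y) ∧
        (1 + Matrix.diagonal (fun p => (w₁ p : ℂ)) * X) * Nm = 1 ∧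
        (∀ k ∈ klBall L μ 0, ∀ k' ∈ klBall L μ 0, ‖klPairArrayF L M β U μ n Qm k k' - (X * Nm) k k'‖ ≤ Ea k k') ∧
        (∀ x y, transferBarRelIdx L Gth P (klCT7 P R Q₀ G' Gth) β U (n - 1) (n - 1) Qm x y ≤ r') ∧
        (∀ x y, Ea x y + (transferBarRelIdx L Gth P (klCT7 P R Q₀ G' Gth) β U (n - 1) (n - 1) Qm x y +
            3 / 2 * (3 / 2 * m) * ∑ t, transferBarRelIdx L Gth P (klCT7 P R Q₀ G' Gth) β U (n - 1) (n - 1) Qm x t * |w₁ t| +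
            3 / 2 * (3 / 2 * m + r') * ∑ a, |w₁ a| * transferBarRelIdx L Gth P (klCT7 P R Q₀ G' Gth) β U (n - 1) (n - 1) Qm a y +
            9 / 4 * (3 / 2 * m + r') * (3 / 2 * m) *
              ∑ a, ∑ t, |w₁ a| * transferBarRelIdx L Gth P (klCT7 P R Q₀ G' Gth) β U (n - 1) (n - 1) Qm a t * |w₁ t|) ≤ E₁ x y) ∧
        (∀ x y, E₁ x y ≤ e₁) ∧
        (3 / 2 * m + r') * ∑ a, |w₁ a| ≤ 1 / 3 ∧
        (∑ p, |w₁ p| ≤ 3 / 4 * G.bhi) ∧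
        (∑ p, (|w₁ p| - w₁ p) ≤ klEdge G n (klTorusNorm L Qm)) ∧
        (∀ k ∈ klBall L μ 0, ∀ k' ∈ klBall L μ 0,
          E₁ k k' ≤
            drivePBar G P U (n - 1) + eremBar G P Q U β L (n - 1) + thermalBar G P U β n +
              legDressBarQ2 G P Q U n (legSliceCountT L β μ (klFlowFrameU L M β U μ n) n ![k', Qm - k', Qm - k, k]) +
              (P.Klam * U) ^ 2 * (G.phGain n (klTorusNorm L (k - k')) + G.phGain n (klTorusNorm L (k + k' - Qm))) +
              frameShiftBar P Q U n)) :
    PairLadderStepAtV17F2 L M G P Q β U μ n :=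
  pairLadderStepAtV17F2_of_relFamilyK5 L M hCF hKl (klCT7_nonneg P R Q₀ G' Gth) hn hnS hm hK hβ hβL hG hfam hC₀ hsm₀ htower

end Direct

end Summit.HubbardSuperconductivity.HubbardSuperconductivity.Theorems.EngineV8

end
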